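import Literature.Computation.AbelianHilbFock.Fock
import Literature.Computation.AbelianHilbFock.WindowAllN
import Literature.Computation.AbelianHilbFock.WindowCertificate10
import Literature.Computation.Certificates.Blocks
import Literature.Computation.Certificates.Data
import Literature.Computation.Certificates.GramSOS
import Literature.Computation.Certificates.LieDerivative
import Literature.Computation.Certificates.LinearProgramming
import Literature.Computation.Certificates.PosSemidef
import Literature.Computation.Certificates.PosSemidefInt
import Literature.Computation.Certificates.SumOfSquares
import Literature.Computation.FiniteGraph.IsingCorrelationCert
import Literature.Computation.FiniteGraph.IsingPolynomials
import Literature.Computation.FiniteGraph.PolyCert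
import Literature.Computation.FiniteGraph.Reliability
import Literature.Computation.FiniteGraph.ReliabilityBridge
import Literature.Computation.FiniteGraph.SAWDomainTopology
import Literature.Computation.FiniteGraph.SAWInterlacing
import Literature.Computation.FiniteGraph.SAWLatticeDomains
import Literature.Computation.FiniteGraph.SAWPolynomials
import Literature.Computation.FiniteGraph.SAWSharpFugacity
import Literature.Computation.FiniteGraph.SAWWeightBridge
import Literature.Computation.FiniteGraph.SpinSums
import Literature.Computation.KummerOrbifold.Bases
import Literature.Computation.KummerOrbifold.Basics
import Literature.Computation.KummerOrbifold.Certificate5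
import Literature.Computation.KummerOrbifold.Columns
import Literature.Computation.KummerOrbifold.Model5
import Literature.Computation.KummerOrbifold.Sectors
import Literature.Computation.Sparse.DenseAccum
import Literature.Computation.Sparse.Replay
import Literature.Computation.Sparse.SparseFinsupp
import Literature.Analysis.ValidatedNumerics.Certificate

/-!
# `Literature/Computation` — README and index of the compute infrastructure (APPEND-ONLY)

`Literature/Computation/<Area>/…` holds COMPUTE INFRASTRUCTURE: sorry-free, fact-free Lean files
whose job is to let a finite computation done off-line (a `kit compute` job, an exact rational
solver, a search) enter a proof as DATA plus `by decide +kernel` (or `native_decide` under the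
`--computational` regime and the certification lane, docs/reference/compute.md §7), with the
soundness of the checker proved once and for all. This file is the directory's README: one section
per area, each maintained by the unit that builds the area — APPEND a section (draft-pull this
file, add below, keep the imports sorted), never rewrite another unit's section. The `example`s at
the bottom are cross-module integration tests, kernel-checked at every build; besides them the
file declares only the three checkers packaged in the tree's `Verifier` shape
(`lpVerifier`, `psdVerifier`, `sosVerifier`, §1), the uniform entry points for named-hypothesis
style use (`V.claim cert (by decide +kernel)`).

Areas (2026-08-16):
* `Certificates/` — rational LP-dual / Farkas, PSD / PD (Gram–`LDLᵀ`) and SOS / Positivstellensatz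
  certificate checkers (unit `infra-psd-sos-lp-checker`; §§1–6 below).
* `FiniteGraph/` — finite-graph witness engine (unit `infra-finite-graph-witness-engine`; its section is
  the second `# Area` below): exact Ising spin sums / correlation polynomials, certified inverse of the
  second-moment matrix, exact connection probabilities, SAW length polynomials of lattice domains,
  interlacing / pairing / simple-connectivity checks, sign certificates for rational polynomials —
  the kernel side of finitely refutable statements about `gksExpect`, `prodBernoulli`/`openConn` and
  `SAW.weight` (consumers: `InverseMFerromagnet`, `AdditiveGluing`, `BoundaryTP2`, `LeftRightFKG`).

General rules for all areas (measured, §3): computable layers use plain structural recursion on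
`ℕ`/`List`/`Fin`-indexed `Finset` sums over `ℚ`/`ℤ` (kernel arithmetic is GMP-backed), never
well-founded recursion, `Finsupp`, `ℝ`, or floating point; statements are in Mathlib vocabulary
with the rational data cast into the target field; data literals follow the formatting rules of §3
(type-ascribed inner lists, `maxRecDepth`), which decide whether a 5 000-term certificate elaborates
in seconds or times out.

# Area `Certificates/` (unit infra-psd-sos-lp-checker)

## 1. What is here (all under namespace `Literature.Computation.Certificates`; the three `Verifier`
packagings `lpVerifier` / `psdVerifier` / `sosVerifier` are declared in THIS file)

| file | certificate predicate (decidable) | soundness theorem(s) | conclusion |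
|---|---|---|---|
| `Certificates/LinearProgramming.lean` | `LP.IsDualCert A b E f c δ y z` (`y ≥ 0`, `yᵀA + zᵀE = cᵀ`, `yᵀb + zᵀf ≤ δ`); `LP.IsIneqCert` (no `E`); `LP.IsStdDualCert A c y` (`y ≥ 0`, `Aᵀy ≥ c`); `LP.IsFarkasCert` | `.sound`, `.sound_lt`, `IsStdDualCert.sound`, `IsFarkasCert.infeasible` | `∀ x : Fin n → R`, `A x ≤ b → E x = f → ∑ j, c j * x j ≤ δ` (resp. `< δ`, `≤ b·y`, `False`) |
| `Certificates/PosSemidef.lean` | `PSD.IsGramCert A d B` (`d ≥ 0`, `A i j = ∑ k, d k * B k i * B k j`, i.e. `A = Bᵀ·diag d·B`, exact); `PSD.IsGramCertDD A d B` (`d ≥ 0`, residual `A − Bᵀ·diag d·B` symmetric diagonally dominant — ROUNDED factors, small digits); `PSD.IsDiagDominant M`; `PSD.IsGramCertPD A ε d B` (`0 < ε`, Gram certificate of `A − ε•1`) | `quadForm_eq/_nonneg/_nonneg'`, `dotProduct_mulVec_nonneg`, `posSemidef`, `posSemidef_rat` (exact and `DD`); `IsDiagDominant.quadForm_nonneg`;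 `quadForm_ge/_pos`, `posDef`, `posDef_rat` | `0 ≤ ∑ i, ∑ j, x i * A i j * x j`, `(A.map (Rat.cast : ℚ → R)).PosSemidef` / `.PosDef` |
| `Certificates/SumOfSquares.lean` | `SOS.Poly.check p gs hs cert : Bool` (weights `≥ 0` and `p − Σ w q² − Σ gᵢ·sᵢ − Σ hⱼ·tⱼ ≡ 0` coefficientwise); `SOS.Poly.checkP p gs hs certP` (Schmüdgen/Handelman form: weighted-SOS multipliers on products `∏_{i∈S} gᵢ`) | `SOS.Poly.nonneg_of_check`, `nonneg_of_check_nil`, `nonneg_of_checkP` | `∀ x : ℕ → R`, `(∀ g ∈ gs, 0 ≤ g.eval x) → (∀ h ∈ hs, h.eval x = 0) → 0 ≤ p.eval x` |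
| `Certificates/PosSemidefInt.lean` | `PSD.IsGramCertZ A d B` for INTEGER `A`, `B` and `d : Fin m → ℕ` (residual `A − Bᵀ·diag d·B` symmetric diagonally dominant; the cheap kernel path, ≈ 3× less kernel work than `ℚ`); `PSD.IsDiagDominantZ` | `quadForm_nonneg/'`, `dotProduct_mulVec_nonneg`, `posSemidef` (`(A.map Int.cast).PosSemidef`), rational bridge `quadForm_nonneg_of_smul` / `posSemidef_of_smul` (`A = c • Aq`, `0 < c`) | as above, for `A.map Int.cast` resp. `Aq.map Rat.cast` |
| `Certificates/GramSOS.lean` | SOS multipliers in GRAM FORM `σ = m(x)ᵀ Q m(x)`: `SOS.GramSOS` (`s m mb Q d B`), `GramSOS.Valid` (= `PSD.IsGramCertDD Q d B`); one-shot `SOS.Poly.checkG p gs hs certG`, decomposed `nonneg_of_validG` (PSD facts + residual zero-test as separate hypotheses) | `GramSOS.eval_poly(_nonneg)`, `Poly.nonneg_of_checkG`, `Poly.nonneg_of_validG` | as for `SumOfSquares` |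
| `Certificates/Blocks.lean` | — (helper) `forall_fin_of_blocks b`, `forall_fin_of_split k`: prove `∀ i : Fin n, P i` block by block, one `decide +kernel` each; `.intro` lemmas of every predicate expose the conjuncts | — | — |
| `Certificates/Data.lean` | — (helper) list-backed carriers `matrixOfRows m n rows`, `vecOfList n l`, `funOfList d n l` for LARGE data (plain `List` literals elaborate and compile linearly; `!![…]` does not compile in reasonable time beyond ≈ 20 × 20 under `native_decide`) | `…_apply` (`rfl`), `matrixOfRows_eq_of_forall` | — |

`R` is any linearly ordered field (`[Field R] [LinearOrder R] [IsStrictOrderedRing R]`), in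
practice `ℝ` or `ℚ`; all certificate DATA are rational and are cast into `R` in the conclusions.
Sources: weak LP duality / Farkas, `LDLᵀ`, Gram-matrix SOS and Positivstellensatz certificates as
in Blekherman–Parrilo–Thomas, *Semidefinite Optimization and Convex Algebraic Geometry* (SIAM
2012) §2.1.1 (2.3), App. A.1.2, Thm 3.39/3.43/3.127; rational SOS rounding: Peyrl–Parrilo, TCS 409
(2008). The statement shape ("checker accepts ⇒ claim") is that of
`Literature.Analysis.ValidatedNumerics.Verifier` (`Analysis/ValidatedNumerics/Certificate.lean`),
whose interval arithmetic (`ArithExpr.enclose`, `IntervalPolynomial`, `MultiPrecisionBall`) is the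
companion tool for the non-polynomial (transcendental / radial-function) estimates.

## 2. How a seat uses it (templates = the `example`s below and at the end of each file)

1. Off-line, compute the certificate in EXACT rational arithmetic (or float + rational repair) and
   print Lean literals (§4). Ship data as `def`s with docstrings (`[folklore]` tag) or inline.
2. State the goal in the file's vocabulary and close the certificate predicate by
   `decide +kernel`:
   * LP: `refine LP.IsIneqCert.sound (y := ![…]) ?_ x hA; decide +kernel` proves
     `∑ j, (c j : ℝ) * x j ≤ δ` from `hA : ∀ i, ∑ j, (A i j : ℝ) * x j ≤ b i`. `≥`-rows, lower
     bounds and variable bounds: negate rows / objective; equality goal: two certificates;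
     strict goal: `sound_lt` with any rational `δ' < δ` carrying the certificate.
   * PSD: `refine PSD.IsGramCert.posSemidef (d := ![…]) (B := !![…]) ?_; decide +kernel` proves
     `((A : Matrix (Fin n) (Fin n) ℚ).map (Rat.cast : ℚ → ℝ)).PosSemidef` (exact `A = BᵀDB`), and
     `PSD.IsGramCertDD.posSemidef` does the same from a ROUNDED factor whose residual is diagonally
     dominant (recommended beyond `n ≈ 20`: exact `LDLᵀ` digits grow linearly in `n`); `quadForm_nonneg'`
     gives the Bochner-type shape `0 ≤ ∑ i, ∑ j, x i * x j * A i j`; `IsGramCertPD.posDef` for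
     definiteness with an explicit margin `ε` (also a certified lower bound `ε ∑ xᵢ² ≤ xᵀAx`,
     `quadForm_ge`, i.e. a rational lower bound on `λ_min`).
   * PSD, cheap path: scale to integers and use `PSD.IsGramCertZ.posSemidef` /
     `posSemidef_of_smul (c := …)` (`PosSemidefInt.lean`); split with `IsDiagDominantZ.intro` +
     `forall_fin_of_blocks` when one `decide` is too big (§3).
   * SOS: `have h := SOS.Poly.nonneg_of_check (p := …) (gs := …) (hs := …) (cert := …)
     (by decide +kernel) (SOS.vars [a, b, …]) hgs hhs`, then
     `simp only [SOS.Poly.eval_cons, SOS.Poly.eval_nil, SOS.Monomial.eval_eq,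
     SOS.Monomial.evalFrom_cons, SOS.Monomial.evalFrom_nil, SOS.vars_cons_zero,
     SOS.vars_cons_succ] at h; push_cast at h; linarith` closes a concrete polynomial
     inequality in `a b … : ℝ`. Hypotheses `hgs : ∀ g ∈ gs, 0 ≤ g.eval x` are produced from
     the user's `0 ≤ …` facts by the same `simp` set (see the tests in `SumOfSquares.lean`).
   * SOS in Gram form (what an SDP solver + rounding delivers): `SOS.Poly.nonneg_of_checkG` with a
     `CertG` record (`GramSOS.lean`), or `nonneg_of_validG` with the PSD facts proved separately.
3. `lean check` the file; propose as usual. A certificate that is too big for the kernel can be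
   closed by `native_decide` instead — then propose with `--computational` (the axiom audit admits
   `Lean.ofReduceBool`; such constants count as proved only after the certification lane re-runs
   them, docs/reference/compute.md §7).

## 3. Cost model (measured 2026-08-16 on the farm, `decide +kernel`, exact rationals)

* Kernel arithmetic is GMP-backed (`Nat.add/mul/div/mod/gcd` are kernel primitives), so exact
  `ℚ` is cheap: a Gram check with `n = m = 15` takes ≈ 1 s, `n = m = 30` ≈ 25 s, `n = m = 40`
  with the ≈ 340-digit entries of an EXACT `LDLᵀ` ≈ 65 s (cubic in `n`, mildly dependent on digit
  counts: ≈ 4 min at 60 — beyond that use `native_decide`, or better keep digits small with the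
  rounded form `IsGramCertDD`: float factor rounded to ~6 digits + diagonally dominant residual); an LP certificate costs `O(m·n)`
  rational operations (thousands of rows × columns are fine); an SOS certificate with 35 squares
  of 15-term polynomials in 4 variables (7 875 raw product terms, 7-digit numerators and
  denominators) checks in ≈ 30 s.
* ELABORATING THE LITERALS is the trap, not the kernel: (i) put a type ascription on every inner
  list literal — write a term as `(([2, 0, 1] : List ℕ), (-7 : ℚ)/3)` (or `mkRat (-7) 3`), never
  `([2, 0, 1], -7/3)` (≈ 70 ms per term otherwise: 54 s for 740 terms vs 2 s); (ii) never put bare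
  negative numerals in a `List ℤ` literal (quadratic; use `ℚ`/`mkRat` or `Int.negSucc`-free
  encodings); (iii) long list literals need `set_option maxRecDepth 100000 in` (the `[…]` macro
  nests), and big `decide +kernel` calls `set_option maxHeartbeats 0 in` (a gate NOTE, allowed);
  (iv) `!![…]` matrices with `(n : ℚ)/d` entries elaborate fine (40 × 40 in ≈ 3 s) and are fine for
  `decide +kernel`, but the COMPILER behind `native_decide` chokes on them (> 10 min at 35 × 35): ship
  large data as `List` literals through `matrixOfRows` / `vecOfList` / `funOfList` (`Data.lean`; 4 s
  for the same 35 × 35 under `native_decide`, and ≈ 20 % faster in the kernel too).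
* THE KERNEL MEMORY CAP (the binding constraint, not time): one `decide +kernel` is ONE kernel
  reduction whose cache keeps every intermediate term; the farm runs `lean --memory=12288`, and a
  reduction exceeding it dies with "(kernel) excessive memory consumption" — which `decide` reports
  misleadingly as "failed to reduce to isTrue/isFalse … got stuck at …" (it cannot unfold `ℚ`
  arithmetic in the elaborator to diagnose). Budget ≈ 60–90 s of exact `ℚ` arithmetic per call:
  a rounded Gram certificate (`IsGramCertDD`) of size 30 passes, size 35 does not; in `ℤ`
  (`IsGramCertZ`) size 35 passes in ≈ 30 s and size 60 does not. REMEDY: split — every predicate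
  has an `.intro` lemma exposing its conjuncts, and `forall_fin_of_blocks b` (`Blocks.lean`) cuts a
  `∀ i : Fin n, …` conjunct into `⌈n/b⌉` guarded blocks, each its own `decide +kernel` after
  `intro c; fin_cases c` (measured: the size-35 `ℚ` certificate passes as `intro` + 2 × 3 blocks in
  160 s). `native_decide` has no such cap but compiles the literals first (minutes for a
  `35 × 35` `!![…]`) and needs the certification lane.
* Keep one certificate per file when it is large (Theorems files are capped at 400 lines only
  under `Summits/…/Theorems`; data `def`s may live in a sibling `…Data.lean`).

## 4. Emitting literals from Python (exact `fractions.Fraction` data)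

```
def q(x):    # Fraction -> Lean ℚ literal
    return f"({x.numerator} : ℚ)" if x.denominator == 1 else f"({x.numerator} : ℚ)/{x.denominator}"
def vec(v):  return "![" + ", ".join(q(x) for x in v) + "]"                      # Fin m → ℚ
def mat(M):  return "!![" + "; ".join(", ".join(q(x) for x in r) for r in M) + "]"  # Matrix
def rows(M): return "[" + ", ".join("[" + ", ".join(q(x) for x in r) + "]" for r in M) + "]"  # for matrixOfRows m n
def mono(e): return "([" + ", ".join(str(k) for k in e) + "] : List ℕ)"        # exponent vector
def poly(d): return "[" + ", ".join(f"({mono(e)}, {q(c)})" for e, c in d.items()) + "]"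
def sos(ws_qs): return "[" + ", ".join(f"({q(w)}, {poly(qk)})" for w, qk in ws_qs) + "]"
# SOS certificate record:  ⟨{sos(free)}, [{', '.join(sos(s) for s in ineq_mults)}], [{', '.join(poly(t) for t in eq_mults)}]⟩
```
A rational `LDLᵀ` (for `PSD.IsGramCert`, and to turn a PSD Gram matrix `Q` of an SOS problem into
the weighted squares `Σ_k d_k (L_kᵀ m(x))²` that `SOS.Poly.Cert.sos` expects) is ten lines of
`Fraction` arithmetic with symmetric pivoting; singular pivots are skipped (rank-deficient `Q`
gives `m < n` rows). For `PSD.IsGramCertDD`: `numpy.linalg.cholesky` (or `ldl`) in floats, round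
`B`, `d` with `Fraction(x).limit_denominator(10**6)`, compute the exact residual
`R = A − Bᵀ·diag d·B` in `Fraction`s and test `sum(|R[i][j]|, j ≠ i) ≤ R[i][i]` before emitting;
if it fails, shift a little weight from `d` into the residual's diagonal (decrease `d` by a few ulp)
or round to more digits.

## 5. Shape notes for the three target cruxes (what maps where; no claim about feasibility)

* `OnePercentCertificate` (ThreeConeCertificate, stmt-AtomisticToContinuum-11958): the clause
  `∀ n y w, 0 ≤ ∑ i, ∑ j, w i * w j * f (dist (y i) (y j))` is a positive-type condition for ALL
  finite configurations — not a finite matrix check; it is discharged structurally (e.g. `f` a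
  nonnegative rational combination of manifestly positive-type radial functions, each finite Gram
  matrix then being PSD by `quadForm_nonneg'`-type sums), while the finite-range stability clause
  `-(c N) ≤ Σ_{i<j} g` reduces, via a one-centre inequality over finitely many distance classes,
  to LP-dual certificates (`LP.IsIneqCert.sound`) combined with interval enclosures of `g` on each
  class (`Literature.Analysis.ValidatedNumerics`); the scalar clause `c + f 0 / 2 ≤ 29/40` is
  `norm_num`.
* `PolynomialSlack` / `HyperoctahedralThreshold` (SnSubsetDichotomy, stmt-MatrixMultiplication-8306
  / -10883): both are asymptotic in `n`, so certificates enter as finite-`n` lemmas — LP / SDP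
  (Delsarte–Schrijver-type) UPPER bounds on `|S||T||U|` over TPP configurations in `S_n` for
  small `n` are `LP.IsIneqCert` / `PSD.IsGramCert` checks of the dual solution, and explicit TPP
  triples (lower bounds, the deciding side of `HyperoctahedralThreshold`) are `decide`-checked
  directly on `Finset (Equiv.Perm (Fin n))` without this directory. Polynomial inequalities in
  auxiliary real parameters (densities, exponents) with polynomial side conditions are
  `SOS.Poly.nonneg_of_check`.

## 6. Not here / next

No solvers; no floating point; no `MvPolynomial` bridge (Mathlib polynomials are noncomputable —
the bridge to a concrete goal is `simp` + `ring`/`linarith` on `Poly.eval`); no sparse-matrix or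
block formats (a block-diagonal Gram certificate is a Gram certificate with a sparse `B`); no DSOS/
SDSOS or interval-SOS hybrids yet. Extensions go in new files under `Certificates/` with the same
discipline: decidable predicate or `Bool` checker on rational data + soundness over ordered fields
+ kernel-checked `example`s.

# Area `FiniteGraph/` (unit infra-finite-graph-witness-engine; appended 2026-08-17)

## 1. What is here (namespace `Literature.Computation.FiniteGraph`; parts I–XII, all proved, no facts)

| part · file | computable layer (kernel-evaluable) | bridge / soundness theorem(s) | conclusion shape |
|---|---|---|---|
| I `SpinSums` | `isingSumZ n bonds mono ∈ ℤ`, `isingExpect … ∈ ℚ` (bond `(u,v,a,b)`: `tanh K = a/b`) | `gksExpect_listProd_eq`, `gksExpect_spinAt_mul_spinAt_eq`, `gksExpect_spinProduct_eq`; `tanh_artanh_div` | `gksExpect univ K C (σ_{x₁}⋯σ_{x_r}) = (isingExpect n L xs : ℝ)` for `C i = {uᵢ,vᵢ}`, `tanh (K i) = aᵢ/bᵢ` |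
| II `IsingCorrelationCert` | `corrNumZ` (all `⟨σᵢσⱼ⟩` numerators in one pass), `invCheck`, `imCertCheck n L B x y`, `imNonposCheck n L B` | **`exists_inv_entry_pos_of_imCertCheck`** (negation shape of `InverseMFerromagnet`), `model_corrMatrix_eq/_inv_eq` (exact `Σ`, `Σ⁻¹`), **`inv_entry_nonpos_of_imNonposCheck`** (positive evidence: this model is inverse-`M`) | `∃ m K C p q, (∀ i, 0 ≤ K i) ∧ (∀ i, (C i).card = 2) ∧ p ≠ q ∧ 0 < (Matrix.of (⟨σ_pσ_q⟩))⁻¹ p q`; resp. `… ⁻¹ x y ≤ 0` for all `x ≠ y` |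
| III `Reliability` | `connNumZ`, `connDen`, `connProb n E o T ∈ ℚ` (edge `(u,v,a,b)` open w.p. `a/b`; union–find labels, pruning) | `LabelsOK`, `reachable_cfgOf_cons_iff` | — |
| IV `ReliabilityBridge` | `edgeWeight n E : Sym2 (Fin n) → unitInterval`, `edgesOK`, `agCertCheck n E A o b` | `prodBernoulli_real_iUnion_openConn_eq` (`(prodBernoulli w).real (⋃ t∈T, openConn o t) = connProb`), **`exists_additiveGluing_violation_of_check`** | `∃ w A o b t, 0 ≤ t ∧ (∀ a ∈ A, 1 − t ≤ P(a ↔ b)) ∧ P(o ↔ b) < P(o ↔ A) − t` (negation shape of `AdditiveGluing`) |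
| V `PolyCert` | `peval`, `padd/psmul/pmul/psub`, `pshift`, `plb`, `posCert p d lo hi` | `posCert_sound` | `∀ x ∈ [lo, hi], 0 < peval p x` (exact rational branch-and-bound) |
| VI `SAWPolynomials` | `sawSupports`, `sawHist`, `sawCounts S a b : List ℕ` (SAWs of `ℤ²[S]` by length) | completeness `map_support_mem_sawSupports`, soundness `exists_walk_of_mem_sawSupports`, `nodup_sawSupports`, `length_le_of_isPath` | under `hG : G.Adj x y ↔ (zdGraph 2).Adj x y ∧ toPair x ∈ S ∧ toPair y ∈ S` |
| VII `SAWWeightBridge` | `sawPoly`, `sawPolyAvoiding`, `avoids a b V` | **`SAW_weight_univ_eq`** (`SAW.weight Ω δ a b univ = ofReal (peval (sawPoly S a b) x_c)`), `weight_mul_weight_lt_of_posCert` (+ `_le_`), `SAW_weight_avoids_eq`, `weight_avoids_mul_lt_of_posCert`; `criticalFugacity_mem_Icc_third_half` | `Z(a₁,b₁)Z(a₂,b₂) < Z(a₃,b₃)Z(a₄,b₄)` from one `posCert` on `[lo,hi] ∋ x_c` (TP₂ / FKG shapes and their negations) |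
| VIII `SAWLatticeDomains` | `boxList` | `adj_iff_of_latticeDobrushin`, `box_adj_iff` (discharge `hG`), `SAW_weight_box_eq`, `box_weight_mul_weight_lt_of_posCert(_third_half)`, `box_weight_avoids_mul_lt_of_posCert` | hypothesis-free on boxes `siteDomain (boxSites a b)`, mesh `1` |
| IX `SAWSharpFugacity` (COMPUTATIONAL: `native_decide` axioms of the μ bounds) | — | `criticalFugacity_mem_Icc_sharp` (`x_c ∈ [200/539, 5/13]`), `*_sharp` versions of VII–VIII | needed from `5 × 5` on |
| X `IsingPolynomials` | `satCount`, `isingHist`, `isingPoly n E mono : List ℚ` (numerator `N_A(t)`, `t = tanh β`, uniform coupling), `prodPoly`, `ipCertCheck n E lhs rhs d lo hi` | **`gksExpect_uniform_eq`** (`⟨σ_xs⟩_β = N_xs(tanh β)/N_[](tanh β)`, any real `β`), `peval_isingPoly_nil_pos`, **`prod_gksExpect_lt_of_ipCertCheck`**; `listSpin_pair/_four` | `∀ β, tanh β ∈ [lo,hi] → Π_{A∈lhs} ⟨σ_A⟩_β < Π_{B∈rhs} ⟨σ_B⟩_β` (all-coupling correlation inequalities or their reversal) |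
| XI `SAWInterlacing` | `inducedZ2 S`, `pathOK`, `disjointB`, `bfs`/`separatedB`, `meetsAllB`, `connectedB`, `tp2ViolationCheck` | `exists_domainSAW_of_pathOK`, `exists_disjoint_domainSAW_of_check`, **`domainSAW_meets_of_meetsAllB`**, `latticeDomainOfList`/`list_adj_iff` (every connected site list is a lattice Dobrushin domain), `SAW_weight_list_eq`, `list_weight_mul_weight_lt_of_posCert`, **`exists_tp2Violation_of_check`**, **`not_tp2_forall_of_check`** | the body of `¬ BoundaryTP2` (bounded, simply connected `Ω`, `0 < δ`, interlacing, two disjoint pairings, `Z₁₂Z₃₄ < Z₁₃Z₂₄`) modulo `SimplyConnectedSpace (siteDomain _)` |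
| XII `SAWDomainTopology` | `locallyOneSidedB`, `interIsBoxB`, `glueBoxCheck` | `siteDomain_inter`, `siteDomain_union_eq_of_locallyOneSided`, `isSimplyConnected_siteDomain_boxList`, **`isSimplyConnected_siteDomain_append_of_check`** (glue a box along a box overlap: van Kampen's easy half from `Literature.Topology.FourManifolds`), `not_tp2_forall_of_boxCheck` | `SimplyConnectedSpace` for boxes, L/T/U-shapes, slit/notched boxes, combs, … |

The four negation-shaped ENTRY POINTS are also packaged as `Verifier`s in THIS file (§ below the
docstring): `imVerifier` (¬`InverseMFerromagnet` shape), `agVerifier` (¬`AdditiveGluing` shape),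
`tp2BoxVerifier` (¬`BoundaryTP2` shape on a box), `ipVerifier` (all-coupling product inequality).

## 2. How a seat uses it (one `decide +kernel` per certificate; `native_decide` + `--computational` beyond the kernel cap)

* `InverseMFerromagnet` (stmt-CriticalPhenomena-4798). REFUTE: find bonds `L` (ferromagnetic `0 ≤ a < b`) and
  the exact inverse `B = Σ⁻¹` with some `B_{xy} > 0`, `x ≠ y`; then
  `exists_inv_entry_pos_of_imCertCheck n L B x y (by decide +kernel)` is the negation instance and
  `fun h => …` closes `¬ InverseMFerromagnet` in three lines (`fgwe.py ising cert` prints the file).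
  EVIDENCE for one model: `inv_entry_nonpos_of_imNonposCheck (by decide +kernel) x y hxy`
  (`fgwe.py ising nonpos`). All-temperature comparisons of correlation PRODUCTS on a fixed graph
  (GKS/Lebowitz/interlacing shapes): `prod_gksExpect_lt_of_ipCertCheck` (`fgwe.py ising polycert`).
* `AdditiveGluing` (stmt-CriticalPhenomena-4576). REFUTE: weighted edges `E`, relays `A`, `o`, `b` with
  `P(o↔b) < P(o↔A) − max_a P(a↮b)`; `exists_additiveGluing_violation_of_check n E A o b (by decide +kernel)`
  gives `w, A, o, b, t` in the literal negation shape (`fgwe.py perc cert`; `perc ag` prints all slacks of a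
  weighted graph, `perc scan` surveys small graphs). Any other `prodBernoulli`/`openConn` probability of a
  union of connection events from one origin is `prodBernoulli_real_iUnion_openConn_eq` + `decide`.
* `BoundaryTP2` (stmt-CriticalPhenomena-7115). REFUTE on a lattice domain built from boxes glued along box
  overlaps (`S = boxList a₁ b₁ ++ boxList a₂ b₂ ++ …`): `not_tp2_forall_of_check S p₁ p₂ p₃ p₄ l₁₂ l₃₄ l₁₄ l₂₃ hsc hlo hhi (by decide +kernel)`
  where `hsc` is `simplyConnectedSpace_of_isSimplyConnected` of a chain of
  `isSimplyConnected_siteDomain_append_of_check` ending in `isSimplyConnected_siteDomain_boxList`, each link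
  one `decide`, and `hlo/hhi` are `criticalFugacity_mem_Icc_third_half.1/.2` (axiom-clean, enough up to
  `5 × 4`) or `criticalFugacity_mem_Icc_sharp.1/.2` (part IX). `fgwe.py saw tp2cert --boxes … --points …`
  searches the pairing witnesses, the bisection depth and prints the whole file; it REFUSES unless the
  reversed inequality certifies. EVIDENCE (interlacing + strict TP₂ at four points of a domain):
  `fgwe.py saw evidence`; boxes only: `fgwe.py saw tp2`, survey `saw tp2scan`.
* `LeftRightFKG` (stmt-CriticalPhenomena-11232) is stated with winding-number domains and a winding order
  on SAWs; the engine serves its finitely-checkable core on lattice domains — products of hull-AVOIDANCE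
  weights `w(avoids V)` (`weight_avoids_mul_lt_of_posCert`, `box_weight_avoids_mul_lt_of_posCert(_sharp)`,
  `fgwe.py saw fkg`) — while the identification of `{z | wind ≠ 0}` for a box boundary loop and of the
  order with avoidance events is problem-side (`Theorems/SAWLeftRightFKG*Wind*.lean`).

## 3. Cost model (measured 2026-08-16/17 on the farm)

Kernel (`decide +kernel`): Ising point evaluation `n = 8`, 9 bonds ≈ 2 s, `n = 12`, 16 bonds ≈ 20 s (part I);
`imCertCheck`/`imNonposCheck` `n = 8` ≈ 5–9 s (one `2^n·(m+n²)` pass + `n³` rationals); Ising POLYNOMIALS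
(part X) `n = 10`, `m = 13`, eight monomials + `posCert` depth 3: 16 s for the whole certificate file;
`connProb`/`agCertCheck` `m ≈ 14` edges on `n ≈ 8` vertices: seconds to 30 s (pruned `2^m`); SAW boxes:
`sawCounts` `3 × 3` ≈ 2 s, `4 × 3` ≈ 4 s, `4 × 4` ≈ 10 s per pair with `set_option maxHeartbeats 800000`
(≈ 7 ms per search node), interlacing `meetsAllB` `4 × 4` corners (184 SAWs, one BFS each) ≈ 10 s.
Compiler (`native_decide`, certification lane): `5 × 5`, `6 × 5` boxes (8 512 / 79 384 corner SAWs) in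
≈ 10 s including interlacing; the enumeration evidence quoted on the SAW routes (boxes to `7 × 6`,
domains ≤ 38 sites) is in this regime. The kernel memory cap of §3 above applies unchanged (one
`decide` = one reduction): split products of certificates into separate `theorem`s when needed.
`posCert` depth: the bound is crude near zeros of the difference polynomial — shrink `[lo, hi]` away
from `t = 0`/`t = 1` (Ising) or use the sharp `x_c` interval (SAW) rather than raising `d` beyond ≈ 12.

## 4. The generator `fgwe.py` (untrusted search + pretty-printer; the kernel re-verifies everything)

`kit/fgwe/fgwe.py` of the unit folder (`run/sessions/literature-prover-infra-finite-graph-witness-engine-g2-0/folder/kit/fgwe/fgwe.py`;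
also attached as evidence `fgwe.py` to the four consumer items) is ONE stdlib-only Python file whose
evaluators mirror the Lean definitions above bit for bit (`fgwe.py selftest` reproduces the kernel
examples of parts I–X) and whose `cert` commands print COMPLETE Lean files (imports, data `def`s,
`theorem …_check : … = true := by decide +kernel`, the negation-shaped theorem and its `¬ ∀ …` form):
`ising expect|inv|cert|nonpos|scan|poly|polycert`, `perc prob|ag|cert|scan`,
`saw counts|tp2|fkg|tp2scan|evidence|tp2cert` (`--native` switches the proofs to `native_decide`;
`--graph6 FILE` feeds nauty/geng output to the scans; python-flint / networkx are used when importable,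
e.g. on the compute pool, never required). Literal formats are those of §4 above (`(a : ℚ) / b`,
type-ascribed lists); sites are `![x, y]`, site lists `[(x, y), …]`, boxes `boxList (x₀, y₀) (x₁, y₁)`.

## 5. Not here / next

No `MvPolynomial`/symbolic multi-coupling Ising polynomials (one `t` for all bonds; several rational
couplings are the point evaluations of parts I–II); no transfer matrices (tori `3 × 3 × L` are out of
`2^n` reach — those checks stay off-line evidence); no winding numbers (LeftRightFKG's literal domain);
no percolation polynomials in a symbolic `p` (AdditiveGluing is refutable at one rational weight vector,
which part IV covers; uniform-`p` families would need the part-IV bridge redone over `peval`). Extensions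
keep the discipline: structural recursion, integers inside, `Bool` checker + soundness to the tree's own
definitions, kernel `example`s, measured costs in the docstring.

# Area `Sparse/` (cell hodge-kum4, seat p1; 2026-08-25)

Sparse-vector ↔ `Finsupp` compute bridge, generic (namespace `Literature.Computation.Sparse`):
| file | computable layer | soundness |
|---|---|---|
| `SparseFinsupp` | `SpVec = List (ℕ × ℚ)`, `toF K`, `scale/sub/applyCols/normalize`, `colOp K col` (= `Finsupp.linearCombination` of the columns) | `toF_applyCols` (list column application = `colOp`), `toF_normalize`, `toF_eq_zero_of_normalize_eq_nil`, `toF_eq_of_normalize_sub` |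
| `DenseAccum` | dense array-segment accumulation `addAtA?/accumColA?/accumA?`, `DSeg` (`zero/accum?/nonzeros/allZero`), arrays threaded linearly | `toFA_accumA?`/`toFD_accum?` (adds `colOp K col (toF s)`; `none` iff an index leaves the segment), `toF_nonzeros`, `toFD_eq_zero_of_allZero` |
| `Replay` | `replay` of a word list (`Step.seed/app`) through column operators; `sl2Residual`; basis-level `basisSl2Check`, `basisShiftCheck`, `diagCol` | `replay_mem` (closure membership BY CONSTRUCTION), `sl2Residual_sound`, `basisSl2Check_sound` (`E(Fδ_i) − F(Eδ_i) = hdeg(i)δ_i`), `basisShiftCheck_sound` |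
Use: define operators as `colOp K col` of column functions computed by ANY code; certify identities on
basis vectors by `native_decide` on the Bool checks; conclude linear-map identities by `Finsupp.lhom_ext`.

# Area `KummerOrbifold/` (cell hodge-kum4, seat p1; 2026-08-25/26)

Computable Fu–Tian–Vial / Fantechi–Göttsche model of `H*(K_{m-1}(A), ℚ)^{A[m]}` (port of the cell's census
implementation g2; namespace `Literature.Computation.KummerOrbifold`): `Basics` (sparse exterior algebra,
permutations, Molien helper), `Sectors` (sectors `K_P`, reduction, the sector product with discrete
torsion, invariant classes), `Bases` (Molien counts, block bases by modular pivoting, class-level `L_x`,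
`h`, `Λ₀`), `Columns` (raw index layout; column functions of `L_{ω₀}`, `Λ₀`, generator multiplications),
`Certificate5` (`m = 5`: `certificate5` — `[L_{ω₀},Λ₀]δ_i = (deg i − 8)δ_i` and `Λ₀` of degree `−2` on all
`70177` raw basis vectors, `native_decide`, ≈ 4 min; `replay5` — the 1566-word closure evidence; and the
`K`-linear packaging `genOp/lefOp/lamOp/degOp/seedVec` with the generated module `modelSpace = C₀`),
`Model5` (kernel consequences: `lef_comp_lam_sub`, `deg_comp_lam_sub` as linear-map identities on
`ℕ →₀ K`, the `C₀` API and its minimality `modelSpace_le`).  Consumers (`--computational`, they inherit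
the certified `native_decide` axiom): `Summits/Ventures/HodgeKum4/Theorems/KummerFixedLocusL1Defs`
(MODEL_X = `KummerOrbifoldModelKum4`) and `…/KummerFixedLocusLefschetzGenerationKum4` (the transport
theorem `le_llvCupSpan_of_modelCore` and L1 of ladder HodgeAV rung H3).
Validation (farm, dev file of the seat): Betti numbers of `Kum²`/`Kum⁴` invariant parts, Fujiki relation
`∫(X₀+tΔ)⁸ = 525(2−10t²)⁴`, `q(δ) = −10`, term counts equal to census g2.

# Area `Certificates/` — addendum: Lie derivatives / chain rule (`LieDerivative.lean`; venture GRIDFUSION seat model-1, 2026-08-26)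

`Certificates/LieDerivative.lean` (imports `GramSOS`): for the sparse polynomials `SOS.Poly`,
`SOS.Poly.pderiv k p` (computable `∂p/∂x_k`), `SOS.Poly.numVars`, and the LIE DERIVATIVE
`SOS.Poly.lieDeriv F V = norm (Σ_{k < numVars V} (∂_k V) · F_k)` along a polynomial vector field
`F : List Poly` (component `k` = `F[k]`, absent components read `0`), with the CHAIN RULE
`SOS.Poly.hasDerivWithinAt_eval_lieDeriv : (∀ k, HasDerivWithinAt (fun τ => z τ k) (eval (z t) (F.getD k [])) s t) →
HasDerivWithinAt (fun τ => eval (z τ) V) (eval (z t) (lieDeriv F V)) s t` (Rouche–Habets–Laloy 1977,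
Ch. I §3.1 (3.1): `V̇*(t) = V̇(t, x(t))`), plus `hasDerivAt_eval_lieDeriv` and the general form
`hasDerivWithinAt_eval` (arbitrary coordinate derivatives). USE: a Lyapunov / sublevel certificate states
its dissipation identity for `p := -(lieDeriv F V) - …` so that `V̇` is COMPUTED IN THE KERNEL from the
typed field `F` and the candidate `V` (no shipped `V̇` literal), and the ODE-level theorems
(`Literature/Analysis/ODE/LyapunovSublevelInvariance.lean`; `Summits/Ventures/GridStability/Lyapunov/`)
receive the hypothesis `HasDerivWithinAt (V ∘ z) …` from the chain rule. First consumers: the recast swing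
models of `Summits/Ventures/GridStability/Models/` (`SMIB.hasDerivWithinAt_embed`,
`RecastData.hasDerivWithinAt_embed{,Rel,Inf}` supply exactly the coordinate hypothesis). Measured cost
(farm, 2026-08-26): `lieDeriv` of a 28-term `V` along a 7-component field with 45-digit rational
coefficients, fully evaluated by `decide +kernel`, < 10 s including the field's own in-kernel construction.

# Area `AbelianHilbFock/` (cell hodge-kum4, lane (V), seat hodge-kum4-veng; 2026-08-27)

Computable Nakajima–Grojnowski SUPER Fock space of an abelian surface `A`, `H*(A) = Λ*ℚ⁴`
(`F_A = ⊕ₙ H*(A^[n];ℚ)`; namespace `Literature.Computation.AbelianHilbFock`): `Fock` — bitmask exterior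
algebra, `τ_{k*}` by the projection formula, monomials of creation operators `q_m(e_I)` with Koszul signs,
annihilators as `−m⟨·,·⟩`-superderivations (Li–Qin–Wang conventions), the Chern-character operators
`𝔊₀(e_I)`, `𝔊₁(e_I)` in the closed form of Li–Qin–Wang IMRN 2002 Thm 4.6 for `K = 0 = e` (`mkG`; `𝔊₀` also as
the derivation `q_m(y) ↦ m q_m(xy)`, `mkG0`, proved equal on `H*(A^[3])` by `G0_deriv_eq_twoPoint3`), the
degree operator `h`, `e_α` and the Lefschetz dual `f_α` for `α = e₀₁ + e₂₃` as second quantisations of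
`h_A`, `L_α`, `Λ_α` (`lambda_sl2`: `[L_α, Λ_α] = h_A` on `Λ*ℚ⁴`; `sl2Check3`: the `sl₂` relations on all of
`H*(A^[3])` incl. odd degrees; `ringA2Numbers_eq`: `(∫D_α⁴, ∫D_α²δ², ∫δ⁴) = (12, −16, 0)` on `A^[2]`;
`betti_10_10`: Göttsche's numbers of the window `H^{≤10}(A^[10])`), monomial bases, lazily memoised mod-`p`
operator columns (`p = 2³¹ − 1`), word replay (`Ctx.replay`), block Gaussian elimination (`Ctx.rankProfile`).
`WindowCertificate10` — `windowClosure10_d6/_d8`: the 1 415 / 8 069 words found by the seat's kit search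
(word `0` = `q₁(1)¹⁰|0⟩`, each other word = one of the 20 lane operators applied to an earlier word) have mod-`p`
graded rank `b_d(A^[10])` for `d ≤ 6 / ≤ 8` (denominator guard inside) ⇒ `H^{≤8}(A^[10];ℚ)` lies in the
(cup product by `H^{≤3}`, `f_α`)-closure of `1` inside `H^{≤10}` (≈ 140 s, `native_decide`).
`WindowAllN` — `allN10_d8`: the SAME words replayed SYMBOLICALLY over `F_p[n]` in the stable coordinates
`B_λ(n) = q_λ q₁(1)^{n−|λ|}/(n−|λ|)!|0⟩` (every lane operator is affine in `n` there; `Op.applyS`), cross-checked at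
`n = 10` against the numeric replay, and a per-(degree ≤ 8, weight)-block Hermite elimination over `F_p[n]`
(`hermiteAllUnits`): the column module is the whole block in all 165 blocks ⇒ for EVERY `n ≥ 10`,
`H^{≤8}(A^[n];ℚ)` lies in that closure (≈ 160 s). Evidence modules: no `Summits` import; the identification
of the computable operators with cup products / the Lefschetz dual on Hilbert schemes is CITED (LQW 2002, LQW
IMRN 2002 Thm 4.6, Oberdieck 2021 §3.2 shape) and numerically validated in the cell's report
`pub/hodge-kum4/veng/REPORT-veng.md` (incl. agreement with `KummerOrbifold/` through the Kapfer–Menet cover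
at `n = 3, 4, 5, 6`). Python twins: `pub/hodge-kum4/veng/{fock,closure,replay,alln}.py`.
-/

namespace Literature.Computation.Certificates

/-! ### The three checkers in the `Verifier` shape (`Analysis/ValidatedNumerics/Certificate.lean`)

Uniform statement shape "checker accepts the certificate ⇒ claim": `V.check i c : Bool`,
`V.claim c h : Claim i`. Certificates are list-backed (`Data.lean`) so that one certificate TYPE
serves all sizes; the claims are over `ℝ`. -/

section Verifiers

open Literature.Analysis.ValidatedNumerics

/-- **LP-dual verifier.** Index: dimensions `m n` and rational data `(A, b, c, δ)` of the claim
"`A x ≤ b ⇒ c·x ≤ δ` for all real `x`"; certificate: the multiplier list `y` (read by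
`vecOfList m`); checker: `decide (LP.IsIneqCert A b c δ y)`; soundness: `LP.IsIneqCert.sound`.
[cite: BlekhermanParriloThomas2012, §2.1.1 (2.3)] -/
def lpVerifier : Verifier
    (Σ m n : ℕ, Matrix (Fin m) (Fin n) ℚ × (Fin m → ℚ) × (Fin n → ℚ) × ℚ)
    (fun i => ∀ x : Fin i.2.1 → ℝ,
      (∀ r, ∑ j, (i.2.2.1 r j : ℝ) * x j ≤ i.2.2.2.1 r) → ∑ j, (i.2.2.2.2.1 j : ℝ) * x j ≤ i.2.2.2.2.2) where
  Cert := List ℚ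
  check i y := decide (LP.IsIneqCert i.2.2.1 i.2.2.2.1 i.2.2.2.2.1 i.2.2.2.2.2 (vecOfList i.1 y))
  sound := fun _ _ h x hA => (of_decide_eq_true h).sound x hA

/-- **PSD verifier.** Index: size `n` and a rational matrix `A`; claim:
`(A.map (Rat.cast : ℚ → ℝ)).PosSemidef`; certificate: `(m, d, rows of B)` of a ROUNDED Gram
certificate (read by `vecOfList` / `matrixOfRows`); checker: `decide (PSD.IsGramCertDD A d B)`;
soundness: `PSD.IsGramCertDD.posSemidef`. [cite: BlekhermanParriloThomas2012, App. A.1.2] -/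
def psdVerifier : Verifier (Σ n : ℕ, Matrix (Fin n) (Fin n) ℚ)
    (fun i => (i.2.map (Rat.cast : ℚ → ℝ)).PosSemidef) where
  Cert := ℕ × List ℚ × List (List ℚ)
  check i c := decide (PSD.IsGramCertDD i.2 (vecOfList c.1 c.2.1) (matrixOfRows c.1 i.1 c.2.2))
  sound := fun _ _ h => (of_decide_eq_true h).posSemidef

/-- **SOS verifier.** Index: target polynomial `p`, inequality hypotheses `gs`, equality
hypotheses `hs`; claim: `p ≥ 0` at every real point satisfying the hypotheses; certificate:
`SOS.Poly.Cert`; checker: `SOS.Poly.check`; soundness: `SOS.Poly.nonneg_of_check`.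
[cite: BlekhermanParriloThomas2012, Thm 3.127] -/
def sosVerifier : Verifier (SOS.Poly × List SOS.Poly × List SOS.Poly)
    (fun i => ∀ x : ℕ → ℝ, (∀ g ∈ i.2.1, 0 ≤ g.eval x) → (∀ h ∈ i.2.2, h.eval x = 0) →
      0 ≤ i.1.eval x) where
  Cert := SOS.Poly.Cert
  check i c := SOS.Poly.check i.1 i.2.1 i.2.2 c
  sound := fun _ _ h x hg hh => SOS.Poly.nonneg_of_check h x hg hh

/-- Test / template: the named-hypothesis use of a verifier — the PSD claim for the `3 × 3` path
matrix extracted from `psdVerifier` with a list-backed rounded certificate. -/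
example : (((!![2, -1, 0; -1, 2, -1; 0, -1, 2] : Matrix (Fin 3) (Fin 3) ℚ)).map
    (Rat.cast : ℚ → ℝ)).PosSemidef :=
  psdVerifier.claim (i := ⟨3, !![2, -1, 0; -1, 2, -1; 0, -1, 2]⟩)
    (3, [2, 7 / 5, 6 / 5], [[1, -1 / 2, 0], [0, 1, -7 / 10], [0, 0, 1]]) (by decide +kernel)

end Verifiers

section IntegrationTests

open SOS SOS.Poly

/-- Integration test (LP → an inequality between named reals): from the half-planes
`u + 2v ≤ 14`, `3u − v ≤ 0`, `u − v ≤ 2` conclude `2u + 4v ≤ 28` (multipliers `y = (2, 0, 0)`);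
shows how to feed scalar hypotheses into the `Fin`-indexed statement and read the result back. -/
example (u v : ℝ) (h₀ : u + 2 * v ≤ 14) (h₁ : 3 * u - v ≤ 0) (h₂ : u - v ≤ 2) :
    2 * u + 4 * v ≤ 28 := by
  have hA : ∀ i, ∑ j, ((!![1, 2; 3, -1; 1, -1] : Matrix (Fin 3) (Fin 2) ℚ) i j : ℝ) * ![u, v] j ≤
      ((![14, 0, 2] : Fin 3 → ℚ) i : ℝ) := by
    intro i
    fin_cases i <;> simp [Fin.sum_univ_succ] <;> linarith
  have h := LP.IsIneqCert.sound (c := ![2, 4]) (δ := 28) (y := ![2, 0, 0]) (by decide +kernel)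
    ![u, v] hA
  simp [Fin.sum_univ_succ] at h
  linarith

/-- Integration test (PSD → SOS by hand): the Gram certificate of `[[2,-1],[-1,2]]`
(`d = (2, 3/2)`, `B = [[1, -1/2], [0, 1]]`) gives the binary form inequality
`0 ≤ 2a² − 2ab + 2b²` through `quadForm_nonneg'`. -/
example (a b : ℝ) : 0 ≤ 2 * a ^ 2 - 2 * a * b + 2 * b ^ 2 := by
  have h := PSD.IsGramCert.quadForm_nonneg' (A := !![2, -1; -1, 2]) (d := ![2, 3 / 2])
    (B := !![1, -1 / 2; 0, 1]) (by decide +kernel) ![a, b]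
  simp [Fin.sum_univ_succ] at h
  linarith

/-- Integration test (the same inequality through the SOS checker, certificate = the weighted
squares `2·(a − b/2)² + (3/2)·b²` read off the same `LDLᵀ`). -/
example (a b : ℝ) : 0 ≤ 2 * a ^ 2 - 2 * a * b + 2 * b ^ 2 := by
  have h := nonneg_of_check_nil
    (p := [(([2] : List ℕ), (2 : ℚ)), (([1, 1] : List ℕ), (-2 : ℚ)), (([0, 2] : List ℕ), (2 : ℚ))])
    (cert := ⟨[((2 : ℚ), [(([1] : List ℕ), (1 : ℚ)), (([0, 1] : List ℕ), (-1 : ℚ)/2)]),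
      ((3 : ℚ)/2, [(([0, 1] : List ℕ), (1 : ℚ))])], [], []⟩)
    (by decide +kernel) (vars [a, b])
  simp only [eval_cons, eval_nil, Monomial.eval_eq, Monomial.evalFrom_cons, Monomial.evalFrom_nil,
    vars_cons_zero, vars_cons_succ] at h
  push_cast at h
  linarith

end IntegrationTests

end Literature.Computation.Certificates

namespace Literature.Computation.FiniteGraph

/-! ### Area `FiniteGraph/`: the four entry points in the `Verifier` shape, and integration tests -/

section Verifiers

open Literature.Analysis.ValidatedNumerics Literature.Probability.LatticeModels
open Literature.Probability.RandomPlanarGeometry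
open Literature.Probability.RandomPlanarGeometry.SAW.FiniteMemory (toPair)

/-- **Inverse-`M` refutation verifier** (shape of `¬ InverseMFerromagnet`): certificate
`(n, L, B, x, y)` = sites, ferromagnetic bonds `(u, v, a, b)` (`tanh K = a/b`), exact `Σ⁻¹`, an entry;
checker `imCertCheck`; soundness `exists_inv_entry_pos_of_imCertCheck`. [cite: FriedliVelenik2017, §3.8.1] -/
def imVerifier : Verifier Unit (fun _ => ∃ (n m : ℕ) (K : Fin m → ℝ) (C : Fin m → Finset (Fin n)) (p q : Fin n),
    (∀ i, 0 ≤ K i) ∧ (∀ i, (C i).card = 2) ∧ p ≠ q ∧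
    0 < (Matrix.of fun r s : Fin n => gksExpect Finset.univ K C (fun ω => spinAt r ω * spinAt s ω))⁻¹ p q) where
  Cert := ℕ × List IsingBond × List (List ℚ) × ℕ × ℕ
  check _ c := imCertCheck c.1 c.2.1 c.2.2.1 c.2.2.2.1 c.2.2.2.2
  sound := fun _ c h => ⟨c.1, exists_inv_entry_pos_of_imCertCheck c.1 c.2.1 c.2.2.1 c.2.2.2.1 c.2.2.2.2 h⟩

/-- **Additive-gluing refutation verifier** (shape of `¬ AdditiveGluing`): certificate `(n, E, A, o, b)`;
checker `agCertCheck`; soundness `exists_additiveGluing_violation_of_check`. [cite: KozmaNitzan2024, Conjectures 1–3] -/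
def agVerifier : Verifier Unit (fun _ => ∃ (n : ℕ) (w : Sym2 (Fin n) → unitInterval) (A : Finset (Fin n)) (o b : Fin n) (t : ℝ),
    0 ≤ t ∧ (∀ a ∈ A, 1 - t ≤ (prodBernoulli w).real (Literature.Probability.Percolation.openConn a b)) ∧
    (prodBernoulli w).real (Literature.Probability.Percolation.openConn o b) <
      (prodBernoulli w).real (⋃ a ∈ A, Literature.Probability.Percolation.openConn o a) - t) where
  Cert := ℕ × List PercEdge × List ℕ × ℕ × ℕ
  check _ c := agCertCheck c.1 c.2.1 c.2.2.1 c.2.2.2.1 c.2.2.2.2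
  sound := fun _ c h => ⟨c.1, exists_additiveGluing_violation_of_check c.1 c.2.1 c.2.2.1 c.2.2.2.1 c.2.2.2.2 h⟩

/-- **Boundary-TP₂ refutation verifier on a box** (shape of `¬ BoundaryTP2`, interval `x_c ∈ [1/3, 1/2]`):
certificate `(a, b, (p₁, p₂, p₃, p₄), (l₁₂, l₃₄, l₁₄, l₂₃), d)`; checker: `a ≤ b` and part XI's
`tp2ViolationCheck`; soundness `not_tp2_forall_of_boxCheck`. General glued-box domains:
`not_tp2_forall_of_check` with `isSimplyConnected_siteDomain_append_of_check`. [folklore] -/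
def tp2BoxVerifier : Verifier Unit (fun _ => ¬ (∀ (Ω : Set ℂ) (δ : ℝ) (p₁ p₂ p₃ p₄ : Site 2),
    Bornology.IsBounded Ω → SimplyConnectedSpace Ω → 0 < δ →
    (∀ (P : SAW.DomainSAW Ω δ p₁ p₃) (Q : SAW.DomainSAW Ω δ p₂ p₄), ∃ v, v ∈ P.walk.support ∧ v ∈ Q.walk.support) →
    (∃ (P : SAW.DomainSAW Ω δ p₁ p₂) (Q : SAW.DomainSAW Ω δ p₃ p₄), List.Disjoint P.walk.support Q.walk.support) →
    (∃ (P : SAW.DomainSAW Ω δ p₁ p₄) (Q : SAW.DomainSAW Ω δ p₂ p₃), List.Disjoint P.walk.support Q.walk.support) →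
    SAW.weight Ω δ p₁ p₃ Set.univ * SAW.weight Ω δ p₂ p₄ Set.univ ≤
      SAW.weight Ω δ p₁ p₂ Set.univ * SAW.weight Ω δ p₃ p₄ Set.univ)) where
  Cert := (ℤ × ℤ) × (ℤ × ℤ) × ((ℤ × ℤ) × (ℤ × ℤ) × (ℤ × ℤ) × (ℤ × ℤ)) ×
    (List (ℤ × ℤ) × List (ℤ × ℤ) × List (ℤ × ℤ) × List (ℤ × ℤ)) × ℕ
  check _ c := decide (c.1.1 ≤ c.2.1.1 ∧ c.1.2 ≤ c.2.1.2) &&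
    tp2ViolationCheck (boxList c.1 c.2.1) c.2.2.1.1 c.2.2.1.2.1 c.2.2.1.2.2.1 c.2.2.1.2.2.2
      c.2.2.2.1.1 c.2.2.2.1.2.1 c.2.2.2.1.2.2.1 c.2.2.2.1.2.2.2 c.2.2.2.2 (1 / 3) (1 / 2)
  sound := fun _ c h => by
    rw [Bool.and_eq_true, decide_eq_true_eq] at h
    have h2 := h.2
    rw [← toPair_ofPair c.2.2.1.1, ← toPair_ofPair c.2.2.1.2.1, ← toPair_ofPair c.2.2.1.2.2.1,
      ← toPair_ofPair c.2.2.1.2.2.2] at h2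
    exact not_tp2_forall_of_boxCheck c.1 c.2.1 h.1 _ _ _ _ _ _ _ _ h2

/-- **All-coupling Ising product-inequality verifier**: index `(n, E, lhs, rhs, lo, hi)`, certificate the
bisection depth `d`; checker `ipCertCheck`; soundness `prod_gksExpect_lt_of_ipCertCheck`.
[cite: FriedliVelenik2017, §3.8.1] -/
def ipVerifier : Verifier (Σ n : ℕ, List (ℕ × ℕ) × List (List (Fin n)) × List (List (Fin n)) × ℚ × ℚ)
    (fun i => ∀ hE : edgesLt i.1 i.2.1 = true, ∀ β : ℝ, (i.2.2.2.2.1 : ℝ) ≤ Real.tanh β → Real.tanh β ≤ i.2.2.2.2.2 →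
      (i.2.2.1.map fun A => gksExpect Finset.univ (fun _ : Fin i.2.1.length => β) (edgeBonds i.1 i.2.1 hE) (listSpin A)).prod <
      (i.2.2.2.1.map fun B => gksExpect Finset.univ (fun _ : Fin i.2.1.length => β) (edgeBonds i.1 i.2.1 hE) (listSpin B)).prod) where
  Cert := ℕ
  check i d := ipCertCheck i.1 i.2.1 (i.2.2.1.map fun A => A.map Fin.val) (i.2.2.2.1.map fun B => B.map Fin.val) d
    i.2.2.2.2.1 i.2.2.2.2.2
  sound := fun _ _ h _ β hlo hhi => prod_gksExpect_lt_of_ipCertCheck h β hlo hhi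

end Verifiers

section IntegrationTests

open Literature.Probability.LatticeModels Literature.Probability.RandomPlanarGeometry

/-- Integration test (parts V, VI, VII, XI): the `3 × 3` box AS A SITE LIST — connected, its corner
points interlaced, and circular TP₂ strict at `x_c` through the site-list weight identity
(axiom-clean interval `[1/3, 1/2]`, depth `0`). -/
example :
    (∀ (P : SAW.DomainSAW (siteDomain {z : Site 2 | SAW.FiniteMemory.toPair z ∈ boxList (0, 0) (2, 2)}) 1 ![0, 0] ![2, 2])
        (Q : SAW.DomainSAW (siteDomain {z : Site 2 | SAW.FiniteMemory.toPair z ∈ boxList (0, 0) (2, 2)}) 1 ![2, 0] ![0, 2]),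
        ∃ v, v ∈ P.walk.support ∧ v ∈ Q.walk.support) ∧
    SAW.weight (siteDomain {z : Site 2 | SAW.FiniteMemory.toPair z ∈ boxList (0, 0) (2, 2)}) 1 ![0, 0] ![2, 2] Set.univ *
        SAW.weight (siteDomain {z : Site 2 | SAW.FiniteMemory.toPair z ∈ boxList (0, 0) (2, 2)}) 1 ![2, 0] ![0, 2] Set.univ <
      SAW.weight (siteDomain {z : Site 2 | SAW.FiniteMemory.toPair z ∈ boxList (0, 0) (2, 2)}) 1 ![0, 0] ![2, 0] Set.univ *
        SAW.weight (siteDomain {z : Site 2 | SAW.FiniteMemory.toPair z ∈ boxList (0, 0) (2, 2)}) 1 ![2, 2] ![0, 2] Set.univ :=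
  ⟨fun P Q => domainSAW_meets_of_meetsAllB (list_adj_iff _ (by decide +kernel)) (by decide +kernel) P Q,
    list_weight_mul_weight_lt_of_posCert (boxList (0, 0) (2, 2)) (by decide +kernel) ![0, 0] ![2, 2] ![2, 0] ![0, 2]
      ![0, 0] ![2, 0] ![2, 2] ![0, 2] (d := 0) criticalFugacity_mem_Icc_third_half.1 criticalFugacity_mem_Icc_third_half.2
      (by decide +kernel)⟩

/-- Integration test (parts II and X): the triangle at `tanh K = 3/5` is inverse-`M` (positive evidence
certificate), and Griffiths' comparison `⟨σ₀σ₁⟩⟨σ₁σ₂⟩ < ⟨σ₀σ₂⟩` holds for ALL couplings with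
`tanh β ∈ [1/100, 1/2]` (polynomial certificate, depth `0`). -/
example : imNonposCheck 3 [(0, 1, 3, 5), (1, 2, 3, 5), (0, 2, 3, 5)]
      [[(323 : ℚ) / 98, (-285 : ℚ) / 196, (-285 : ℚ) / 196], [(-285 : ℚ) / 196, (323 : ℚ) / 98, (-285 : ℚ) / 196],
        [(-285 : ℚ) / 196, (-285 : ℚ) / 196, (323 : ℚ) / 98]] = true ∧
    ∀ β : ℝ, (((1 : ℚ) / 100 : ℚ) : ℝ) ≤ Real.tanh β → Real.tanh β ≤ (((1 : ℚ) / 2 : ℚ) : ℝ) →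
      (([[0, 1], [1, 2]] : List (List (Fin 3))).map fun A => gksExpect Finset.univ (fun _ : Fin 3 => β)
        (edgeBonds 3 [(0, 1), (1, 2), (0, 2)] (by decide)) (listSpin A)).prod <
      (([[0, 2], []] : List (List (Fin 3))).map fun B => gksExpect Finset.univ (fun _ : Fin 3 => β)
        (edgeBonds 3 [(0, 1), (1, 2), (0, 2)] (by decide)) (listSpin B)).prod :=
  ⟨by decide +kernel, fun β hlo hhi => prod_gksExpect_lt_of_ipCertCheck (E := [(0, 1), (1, 2), (0, 2)])
    (lhs := [[0, 1], [1, 2]]) (rhs := [[0, 2], []]) (d := 0) (lo := 1 / 100) (hi := 1 / 2) (by decide +kernel) β hlo hhi⟩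

/-- Integration test (parts III–IV): on the triangle with weights `1/2` the additive gluing inequality
holds (`P(0 ↔ 2) = 5/8 ≥ P(0 ↔ {1}) − P(1 ↮ 2) = 5/8 − 3/8`), so the violation checker rejects. -/
example : connProb 3 [(0, 1, 1, 2), (1, 2, 1, 2), (0, 2, 1, 2)] 0 [2] = 5 / 8 ∧
    agCertCheck 3 [(0, 1, 1, 2), (1, 2, 1, 2), (0, 2, 1, 2)] [1] 0 2 = false := by decide +kernel

end IntegrationTests

end Literature.Computation.FiniteGraph
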